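import Literature.AnabelianGeometry.SemiGraphs.TemperedAbsoluteness
import Literature.AnabelianGeometry.SemiGraphs.TemperedAnabelianWitness
import Literature.AnabelianGeometry.SemiGraphs.TemperedCurveHyperbolicWitness
import HarnessLib

/-!
# [SemiAnbd] §6 / [Mzk8] §4 interface data `CuspidalStructures`, `KummerUnitData`, `KummerTransport`,
# `CyclotomeTransport`: NON-VACUITY (abc-iut L3 inhabitation census v1 §A1 — four zero-producer rows)

Mochizuki, *Semi-graphs of anabelioids*, Publ. RIMS **42** (2006) [SemiAnbd], §6 pp. 77–78 (Cor. 6.10,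
Cor. 6.11, Thm. 6.12), typed in `TemperedAbsoluteness.lean` (abc-iut-L3-t4) over the §6 interface
`TemperedCurve p` through four INTERFACE records quoting [Mzk8] = Mochizuki, *Galois sections in absolute
anabelian geometry*, Nagoya Math. J. **179** (2005) §4: `CuspidalStructures X` (Def. 4.1 (ii)(iii): the
canonical integral / discrete structures on the cuspidal decomposition groups `D_x`, as sets of splitting
subgroups), `KummerUnitData X` (Def. 4.8: `H¹(Π_{X_K}, μ_Ẑ(K))` with the Kummer image of the units),
`KummerTransport kX kY` (the transport maps «induced by `α`»), `CyclotomeTransport X Y` (Thm. 4.3 /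
[SemiAnbd] Thm. 6.12: `μ_Ẑ(K̄) ≅ I_x` by roots of local coordinates, and `μ_Ẑ(K̄) ≅ μ_Ẑ(L̄)` induced by
`α`).  All four had ZERO producers in the kernel (INHABITATION-CENSUS-L3-v1 §A1, abc-iut-w4-d098), so every
predicate of the file (`IsIntegrallyTempAbsoluteCusp`, …, `CuspidalCyclotomicRigidity`) quantified over
uninstantiated data. [cite: MochizukiSemiAnbd2006, §6 pp.77-78]

PROOF-ONLY file (abc-iut cell, NV-L3 lane, seat abc-iut-w5-d010; no `def`/`instance`/`structure`; the
frozen interface is untouched).  Witnesses, HONESTLY LABELLED: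

* `TemperedCurve.toyHyperbolic_isRationalPt` — at abc-iut-L3's NON-DEGENERATE witness
  `TemperedCurve.toyHyperbolic p` (`Π^tp = G_{ℚ_p} × (Ẑ × P)`, one cusp `x` with `D_x = G_{ℚ_p} × Ẑ × 1`,
  `I_x = 1 × Ẑ × 1`) the cusp IS `K`-rational, so the clauses below guarded by «`x` a `K`-rational cusp»
  are NOT vacuous there;
* `TemperedCurve.toyHyperbolic_isSplittingSubgroup` — `S := G_{ℚ_p} × 1 × 1` IS a splitting of
  `1 → I_x → D_x → G_K → 1` (closed, `S ∩ I_x = 1`, `S · I_x = D_x`);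
* `CuspidalStructures.exists_toyHyperbolic` (GENUINE as far as the typed fields go): canonical discrete
  structure `:=` ALL splittings of `D_x`, canonical integral structure `:= {S}`, stable reduction flagged;
  every field holds non-vacuously.  HONEST LIMIT: the record does not carry the `O_K^×`- (resp. `K^×`-) TORSOR
  structure of [Mzk8] Def. 4.1 (only the underlying sets of splittings), and the toy is not a curve — this
  is consistency evidence for the typing, not a model of the canonical structures of a real `X_K`;
  `CuspidalStructures.nonempty_degenerate` — the vacuous inhabitant at `TemperedCurve.degenerate` (no points);
* `KummerUnitData.nonempty` (DEGENERATE / parameter record: `H¹ := ℤ`, unit image `:= ⊤`; the record has no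
  `Prop` field, so ANY abelian group with a subgroup inhabits it — recorded so that consumers know the row
  carries no constraint) for EVERY `X`;
* `KummerTransport.nonempty_of_addEquiv` / `nonempty_self` (constant transport along a given `H¹ ≃+ H¹`,
  ignoring `α` — the record carries no functoriality law; HONEST: degenerate in that sense);
* `CyclotomeTransport.nonempty_degenerate` (VACUOUS: no cusps at `TemperedCurve.degenerate`) and the
  GENUINE-SHAPED `CyclotomeTransport.nonempty_toyHyperbolic_of_mulEquiv`: at the toy, GIVEN an abstract group
  isomorphism `e : Λ(ℚ̄_pˣ) ≃* Ẑ` (classical: «`μ_Ẑ(K̄) ≅ Ẑ(1)`»; supplied by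
  `EtaleTheta.cyclotome.padicAlgCl_nonempty_mulEquiv_zHat` of `EtaleTheta/CyclotomeZHatEquiv.lean`, kept as
  a hypothesis here so that this file does not wait on that module's build), the map
  `μ_Ẑ(K̄) → Π^tp`, `ζ ↦ (1, e ζ, 1)` has image EXACTLY `I_x` — the INTERFACE clause «its image is `I_x`»
  (field `range_cycloToInertiaX` of `CyclotomeTransport`; print, [SemiAnbd] Thm. 6.12 p. 78, speaks of
  «the natural isomorphisms `μ_Ẑ(K̄) ≅ I_x`») holds non-vacuously at a `K`-rational cusp; `cycloOf := id`
  (both curves live in the one `K̄`, as the interface docstring says).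

Nothing here asserts Cor. 6.10 / 6.11 / Thm. 6.12; a model is consistency evidence only; nothing bears on
[IUTchIII] Cor. 3.12.
-/

noncomputable section

namespace Literature.AnabelianGeometry.SemiGraphs

open Literature.AnabelianGeometry.EtaleTheta (cyclotome)

universe u

variable (p : ℕ) [Fact p.Prime]

/-! ### The cusp of the toy is `K`-rational; its canonical splitting -/

namespace TemperedCurve

/-- At `TemperedCurve.toyHyperbolic p` (`K = ℚ_p`, so `G_K = G_{ℚ_p}`), the unique closed point — a cusp
with `D_x = G_{ℚ_p} × Ẑ × 1` — is `K`-RATIONAL: `D_x` surjects onto `G_K` ([Mzk8] §4 p. 33 "`x ∈ X̄_K(K)`").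
[cite: MochizukiSemiAnbd2006, §6 p.77] -/
theorem toyHyperbolic_isRationalPt (x : (toyHyperbolic p).Pt) : (toyHyperbolic p).IsRationalPt x := by
  intro g _
  exact ⟨(g, (1, 1)), (mem_toyDecomp_iff p _).2 rfl, rfl⟩

/-- Membership in the inertia group `I_x = D_x ∩ Δ^tp = 1 × Ẑ × 1` of the toy (stated over the toy
carrier `ToyPi p = G_{ℚ_p} × (Ẑ × P)`). [cite: MochizukiSemiAnbd2006, §6 p.71] -/
theorem mem_toyHyperbolic_inertia_iff (x : (toyHyperbolic p).Pt) (g : ToyPi p) :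
    g ∈ ((toyHyperbolic p).inertia x : Subgroup (ToyPi p)) ↔ g.1 = 1 ∧ g.2.2 = 1 := by
  change g ∈ toyDecomp p ⊓ (ContinuousMonoidHom.fst (GQp p) (ZHat × Iw p)).toMonoidHom.ker ↔ _
  rw [Subgroup.mem_inf, mem_toyDecomp_iff, MonoidHom.mem_ker]
  exact ⟨fun h => ⟨h.2, h.1⟩, fun h => ⟨h.2, h.1⟩⟩

/-- Membership in `S := G_{ℚ_p} × 1 × 1 ⊆ Π^tp`. [cite: MochizukiSemiAnbd2006, §6 p.77] -/
theorem mem_toySplitting_iff (g : ToyPi p) :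
    g ∈ (⊤ : Subgroup (GQp p)).prod (⊥ : Subgroup (ZHat × Iw p)) ↔ g.2 = 1 := by
  simp [Subgroup.mem_prod]

/-- **`S := G_{ℚ_p} × 1 × 1` is a splitting of `1 → I_x → D_x → G_K → 1` at the toy's cusp** ([Mzk8] §4
p. 33): closed, contained in `D_x`, `S ∩ I_x = 1`, `S ⊔ I_x = D_x`. [cite: MochizukiSemiAnbd2006, §6 p.77] -/
theorem toyHyperbolic_isSplittingSubgroup (x : (toyHyperbolic p).Pt) :
    (toyHyperbolic p).IsSplittingSubgroup x
      ((⊤ : Subgroup (GQp p)).prod (⊥ : Subgroup (ZHat × Iw p))) := by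
  haveI : IsGalois ℚ_[p] (AlgebraicClosure ℚ_[p]) := {}
  haveI : T2Space (GQp p) := krullTopology_t2
  change IsClosed (((⊤ : Subgroup (GQp p)).prod (⊥ : Subgroup (ZHat × Iw p)) : Subgroup (ToyPi p)) :
        Set (ToyPi p)) ∧
      (⊤ : Subgroup (GQp p)).prod (⊥ : Subgroup (ZHat × Iw p)) ≤ toyDecomp p ∧
      (⊤ : Subgroup (GQp p)).prod (⊥ : Subgroup (ZHat × Iw p)) ⊓
          (toyDecomp p ⊓ (ContinuousMonoidHom.fst (GQp p) (ZHat × Iw p)).toMonoidHom.ker) = ⊥ ∧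
      (⊤ : Subgroup (GQp p)).prod (⊥ : Subgroup (ZHat × Iw p)) ⊔
          (toyDecomp p ⊓ (ContinuousMonoidHom.fst (GQp p) (ZHat × Iw p)).toMonoidHom.ker) = toyDecomp p
  have hI : ∀ g : ToyPi p,
      g ∈ toyDecomp p ⊓ (ContinuousMonoidHom.fst (GQp p) (ZHat × Iw p)).toMonoidHom.ker ↔
        g.1 = 1 ∧ g.2.2 = 1 := mem_toyHyperbolic_inertia_iff p x
  refine ⟨?_, ?_, ?_, ?_⟩
  · -- closed: the fibre of the (continuous) second projection over `1`
    have hS : (((⊤ : Subgroup (GQp p)).prod (⊥ : Subgroup (ZHat × Iw p)) : Subgroup (ToyPi p)) :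
          Set (ToyPi p)) = (fun g : ToyPi p => g.2) ⁻¹' {1} := by
      ext g; simpa using mem_toySplitting_iff p g
    rw [hS]
    exact isClosed_singleton.preimage (by fun_prop)
  · -- `S ≤ D_x`
    intro g hg
    exact (mem_toyDecomp_iff p g).2 (by rw [(mem_toySplitting_iff p g).1 hg]; rfl)
  · -- `S ∩ I_x = 1`
    refine (Subgroup.eq_bot_iff_forall _).2 fun g hg => ?_
    obtain ⟨hgS, hgI⟩ := Subgroup.mem_inf.1 hg
    exact Prod.ext ((hI g).1 hgI).1 ((mem_toySplitting_iff p g).1 hgS)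
  · -- `S ⊔ I_x = D_x`
    refine le_antisymm (sup_le (fun g hg => (mem_toyDecomp_iff p g).2
      (by rw [(mem_toySplitting_iff p g).1 hg]; rfl)) inf_le_left) fun g hg => ?_
    have hg2 : g.2.2 = 1 := (mem_toyDecomp_iff p g).1 hg
    have hsplit : g = ((g.1, ((1 : ZHat), (1 : Iw p))) : ToyPi p) * ((1 : GQp p), (g.2.1, (1 : Iw p))) := by
      refine Prod.ext (by simp) (Prod.ext (by simp) ?_)
      simp [hg2]
    rw [hsplit]
    exact Subgroup.mul_mem_sup ((mem_toySplitting_iff p _).2 rfl) ((hI _).2 ⟨rfl, rfl⟩)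

end TemperedCurve

/-! ### `CuspidalStructures` ([Mzk8] Def. 4.1 (ii), (iii)) -/

namespace CuspidalStructures

/-- **GENUINE-shaped inhabitant of `CuspidalStructures` at the toy**: stable reduction flagged, canonical
DISCRETE structure at the (rational) cusp `:=` the set of ALL splittings of `D_x ↠ G_K`, canonical INTEGRAL
structure `:= {G_{ℚ_p} × 1 × 1}` (one genuine splitting) — so `canonicalIntegral ⊆ canonicalDiscrete`, every
member is a splitting, and both are nonempty at the rational cusp, all NON-vacuously.  HONEST LIMIT: the
`O_K^×`- (resp. `K^×`-) torsor structures of [Mzk8] Def. 4.1 are not part of the typed record and are not modelled.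
[cite: MochizukiSemiAnbd2006, §6 p.77] -/
theorem exists_toyHyperbolic :
    ∃ S : CuspidalStructures (TemperedCurve.toyHyperbolic p),
      S.HasStableReduction ∧
      (∀ x, S.canonicalDiscrete x = {T | (TemperedCurve.toyHyperbolic p).IsSplittingSubgroup x T}) ∧
      ∀ x, S.canonicalIntegral x = {(⊤ : Subgroup (GQp p)).prod (⊥ : Subgroup (ZHat × Iw p))} :=
  ⟨{ HasStableReduction := True
     canonicalIntegral := fun _ => {(⊤ : Subgroup (GQp p)).prod (⊥ : Subgroup (ZHat × Iw p))}
     canonicalDiscrete := fun x => {T | (TemperedCurve.toyHyperbolic p).IsSplittingSubgroup x T}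
     canonicalIntegral_subset := fun x T hT => by
       rw [Set.mem_singleton_iff.1 hT]
       exact TemperedCurve.toyHyperbolic_isSplittingSubgroup p x
     isSplitting_of_mem := fun _ _ _ _ hT => hT
     canonicalDiscrete_nonempty := fun x _ _ =>
       ⟨_, TemperedCurve.toyHyperbolic_isSplittingSubgroup p x⟩
     canonicalIntegral_nonempty := fun _ _ _ _ => Set.singleton_nonempty _ },
    trivial, fun _ => rfl, fun _ => rfl⟩

/-- `CuspidalStructures` is inhabited at the non-degenerate toy. [cite: MochizukiSemiAnbd2006, §6 p.77] -/
theorem nonempty_toyHyperbolic : Nonempty (CuspidalStructures (TemperedCurve.toyHyperbolic p)) := by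
  obtain ⟨S, -⟩ := exists_toyHyperbolic p
  exact ⟨S⟩

/-- VACUOUS inhabitant at the degenerate witness `TemperedCurve.degenerate p` (no closed points: every
point-indexed field is a function out of the empty type). [cite: MochizukiSemiAnbd2006, §6 p.77] -/
theorem nonempty_degenerate : Nonempty (CuspidalStructures (TemperedCurve.degenerate p)) :=
  ⟨{ HasStableReduction := True
     canonicalIntegral := fun x => PEmpty.elim x
     canonicalDiscrete := fun x => PEmpty.elim x
     canonicalIntegral_subset := fun x => PEmpty.elim x
     isSplitting_of_mem := fun x => PEmpty.elim x
     canonicalDiscrete_nonempty := fun x => PEmpty.elim x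
     canonicalIntegral_nonempty := fun _ x => PEmpty.elim x }⟩

end CuspidalStructures

/-! ### `KummerUnitData` ([Mzk8] Def. 4.8) and `KummerTransport` -/

namespace KummerUnitData

/-- DEGENERATE inhabitant of `KummerUnitData X` for EVERY `X` (parameter record: `H¹ := ℤ`, Kummer image
of the units `:= ⊤`).  The typed record has NO `Prop` field, so any abelian group with a subgroup inhabits
it; no continuous cohomology `H¹(Π_{X_K}, μ_Ẑ(K))` is modelled (interface boundary, TODO-merge
abc-iut-L2-t3 / L4-t1). [cite: MochizukiSemiAnbd2006, §6 p.77] -/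
theorem nonempty (X : TemperedCurve p) : Nonempty (KummerUnitData X) :=
  ⟨{ H1 := ℤ, unitImage := ⊤ }⟩

/-- Two data over two curves with additively isomorphic `H¹` exist (both `:= ℤ`; used for the transport
row). [cite: MochizukiSemiAnbd2006, §6 p.77] -/
theorem exists_pair_addEquiv (X Y : TemperedCurve p) :
    ∃ (kX : KummerUnitData X) (kY : KummerUnitData Y), Nonempty (kX.H1 ≃+ kY.H1) :=
  ⟨{ H1 := ℤ, unitImage := ⊤ }, { H1 := ℤ, unitImage := ⊤ }, ⟨AddEquiv.refl ℤ⟩⟩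

end KummerUnitData

namespace KummerTransport

variable {p}

/-- Inhabitant of `KummerTransport kX kY` from ANY additive isomorphism `e : H¹_X ≃+ H¹_Y`: the CONSTANT
transport `α ↦ e` along isomorphisms of tempered groups and of profinite completions alike.  HONEST: the
typed record carries no law tying the transport to `α` (functoriality, compatibility with the Kummer
images), so this degenerate-in-`α` choice inhabits it. [cite: MochizukiSemiAnbd2006, §6 p.77] -/
theorem nonempty_of_addEquiv {X Y : TemperedCurve p} (kX : KummerUnitData X) (kY : KummerUnitData Y)
    (e : kX.H1 ≃+ kY.H1) : Nonempty (KummerTransport kX kY) :=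
  ⟨{ h1OfTemp := fun _ => e, h1OfHat := fun _ => e }⟩

/-- `KummerTransport kX kX` is inhabited for every datum (identity transport).
[cite: MochizukiSemiAnbd2006, §6 p.77] -/
theorem nonempty_self {X : TemperedCurve p} (kX : KummerUnitData X) : Nonempty (KummerTransport kX kX) :=
  nonempty_of_addEquiv kX kX (AddEquiv.refl _)

/-- For every pair of curves there are Kummer data with an inhabited transport record.
[cite: MochizukiSemiAnbd2006, §6 p.77] -/
theorem exists_pair (X Y : TemperedCurve p) :
    ∃ (kX : KummerUnitData X) (kY : KummerUnitData Y), Nonempty (KummerTransport kX kY) := by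
  obtain ⟨kX, kY, ⟨e⟩⟩ := KummerUnitData.exists_pair_addEquiv p X Y
  exact ⟨kX, kY, nonempty_of_addEquiv kX kY e⟩

end KummerTransport

/-! ### `CyclotomeTransport` ([Mzk8] Thm. 4.3 / [SemiAnbd] Thm. 6.12) -/

namespace CyclotomeTransport

/-- VACUOUS inhabitant at the degenerate witness (no cusps on either side; `cycloOf := id`).
[cite: MochizukiSemiAnbd2006, Thm 6.12 p.78] -/
theorem nonempty_degenerate :
    Nonempty (CyclotomeTransport (TemperedCurve.degenerate p) (TemperedCurve.degenerate p)) :=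
  ⟨{ cycloToInertiaX := fun x => PEmpty.elim x
     cycloToInertiaY := fun y => PEmpty.elim y
     range_cycloToInertiaX := fun x => PEmpty.elim x
     range_cycloToInertiaY := fun y => PEmpty.elim y
     cycloOf := fun _ => MulEquiv.refl _ }⟩

/-- The embedding `Ẑ → Π^tp = G_{ℚ_p} × (Ẑ × P)`, `z ↦ (1, (z, 1))`, precomposed with a group isomorphism
`Λ(ℚ̄_pˣ) ≃* Ẑ`, has image EXACTLY the toy inertia group `I_x = 1 × Ẑ × 1`.
[cite: MochizukiSemiAnbd2006, Thm 6.12 p.78] -/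
theorem range_toyCycloToInertia
    (e : cyclotome (AlgebraicClosure ℚ_[p])ˣ ≃* ZHat) (x : (TemperedCurve.toyHyperbolic p).Pt) :
    (((MonoidHom.inr (GQp p) (ZHat × Iw p)).comp (MonoidHom.inl ZHat (Iw p))).comp
        e.toMonoidHom).range = (TemperedCurve.toyHyperbolic p).inertia x := by
  change _ = toyDecomp p ⊓ (ContinuousMonoidHom.fst (GQp p) (ZHat × Iw p)).toMonoidHom.ker
  ext g
  rw [MonoidHom.mem_range, Subgroup.mem_inf, mem_toyDecomp_iff, MonoidHom.mem_ker]
  constructor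
  · rintro ⟨ζ, rfl⟩
    exact ⟨rfl, rfl⟩
  · rintro ⟨h2, h1⟩
    refine ⟨e.symm g.2.1, Prod.ext ?_ (Prod.ext ?_ ?_)⟩
    · exact h1.symm
    · simp
    · exact h2.symm

/-- **GENUINE-shaped inhabitant of `CyclotomeTransport` at the toy, modulo «`μ_Ẑ(K̄) ≅ Ẑ`»**: given an
abstract group isomorphism `e : Λ(ℚ̄_pˣ) ≃* Ẑ` (classical — `cyclotome.padicAlgCl_nonempty_mulEquiv_zHat`,
`EtaleTheta/CyclotomeZHatEquiv.lean`; an explicit hypothesis HERE only to decouple the build), the datum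
«`μ_Ẑ(K̄) → I_x ⊆ Π^tp`» `:= ζ ↦ (1, e ζ, 1)` on both sides and «`μ_Ẑ(K̄) ≅ μ_Ẑ(L̄)` induced by `α`» `:= id`
satisfies the interface clause «its image is `I_x`» (field `range_cycloToInertiaX`; print, Thm. 6.12
p. 78: «the natural isomorphisms `μ_Ẑ(K̄) ≅ I_x`») NON-vacuously at the `K`-rational cusp.  HONEST LIMIT:
the toy is not a curve; `e` is an orientation of `Ẑ(1)`, not the canonical `G_K`-equivariant identification.
[cite: MochizukiSemiAnbd2006, Thm 6.12 p.78] -/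
theorem nonempty_toyHyperbolic_of_mulEquiv (e : cyclotome (AlgebraicClosure ℚ_[p])ˣ ≃* ZHat) :
    Nonempty (CyclotomeTransport (TemperedCurve.toyHyperbolic p) (TemperedCurve.toyHyperbolic p)) :=
  ⟨{ cycloToInertiaX := fun _ =>
       ((MonoidHom.inr (GQp p) (ZHat × Iw p)).comp (MonoidHom.inl ZHat (Iw p))).comp e.toMonoidHom
     cycloToInertiaY := fun _ =>
       ((MonoidHom.inr (GQp p) (ZHat × Iw p)).comp (MonoidHom.inl ZHat (Iw p))).comp e.toMonoidHom
     range_cycloToInertiaX := fun x _ _ => range_toyCycloToInertia p e x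
     range_cycloToInertiaY := fun y _ _ => range_toyCycloToInertia p e y
     cycloOf := fun _ => MulEquiv.refl _ }⟩

/-- Hence, modulo `Nonempty (Λ(ℚ̄_pˣ) ≃* Ẑ)`, the `CyclotomeTransport` record at the toy pair is inhabited.
[cite: MochizukiSemiAnbd2006, Thm 6.12 p.78] -/
theorem nonempty_toyHyperbolic_of_nonempty_mulEquiv
    (h : Nonempty (cyclotome (AlgebraicClosure ℚ_[p])ˣ ≃* ZHat)) :
    Nonempty (CyclotomeTransport (TemperedCurve.toyHyperbolic p) (TemperedCurve.toyHyperbolic p)) := by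
  obtain ⟨e⟩ := h
  exact nonempty_toyHyperbolic_of_mulEquiv p e

end CyclotomeTransport

end Literature.AnabelianGeometry.SemiGraphs

end
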